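import Summits.BirchSwinnertonDyer.BirchSwinnertonDyer.Theses.KatoDescentPotSupersingular
import Summits.BirchSwinnertonDyer.BirchSwinnertonDyer.Theorems.KatoDescentPotSupersingularWildUpperHeegnerLineMD
import HarnessLib

/-!
# Route `KatoDescentPotSupersingular` (rung K9, wild `3`, cell `bsd-potss`): glue item 23039
# `WildUpperNonsurjTowerOfFourNamedFacts` — the U₀-ns node `WildUpperNonsurjTower` (item 19189) from its five split children
# (the four held named-fact aliases 23034–23037 and the road-inputs bundle 23038)

Cell `bsd-potss`, seat `bsd-potss-k9-c4` g13 (prover); `--workitem stmt-BirchSwinnertonDyer-23039`. Pure glue of plan g25's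
(36c) split of item 19189 (2026-08-27T22:05Z, route rev 26): the four `Held…` aliases are by definition the four Literature
constants {Matar–Nekovář 2019 Thm 0.7, Gross 1991 Prop 3.7 (2), Poitou–Tate duality for Selmer structures (∀ K),
Gross–Zagier 1986 III (3.1) image-free}, the bundle `WildUpperNonsurjRoadInputs` is the conjunction of the six route-side road
inputs, and the kernel is seat g12's landed
`WildUpperHeegnerLineMD.wildUpperNonsurjTower_of_fourNamedFacts_of_maninDrinfeld` (p575492; L₀-free by Manin–Drinfeld at the
optimal member; the J08 optimal-curve road in two-split form, p564108 / p564034 / p573750). The term is the planner's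
farm-certified closer (`split/K9_split_sim.lean`) and the refuter's attached candidate `Glue23039.lean` (evidence, 22:10Z).
HONEST FRAMING: this closes the GLUE item only; the node 19189 then rests BY NAME on four held published facts and the bundle
(whose conjuncts `WildCoatesSujathaResidue` 19942 and the residual `WildRankOne` 19200 are open problems); nothing is booked;
BSD is not proved for any curve.
[cite: MatarNekovar2019, Thm. 0.7 (p. 456)] [cite: GrossLMS1991, Prop. 3.7 (2)] [cite: GrossZagier1986, III (3.1)]
[cite: MilneADT2006, Ch. I, Thm. 4.10] [cite: Manin1972, Cor. 3.6] [cite: Jetchev2008, Cor. 1.5 (p. 812)]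
-/

set_option autoImplicit false
-- the Theorems directory repeats the summit name (sibling precedent `KatoDescentPotSupersingularAssembly.lean`)
set_option linter.dupNamespace false

namespace Summit.BirchSwinnertonDyer.BirchSwinnertonDyer.Theorems

open Summit.BirchSwinnertonDyer.BirchSwinnertonDyer.Theses.KatoDescentPotSupersingular

/-- **Glue 23039**: `HeldMatarNekovarThm07 → HeldGrossProp37Two → HeldPoitouTateSelmerDuality → HeldGrossZagierE0ImageFree →
WildUpperNonsurjRoadInputs → WildUpperNonsurjTower` — unfold the glue and the four held aliases (definitionally the four Literature
constants), destructure the six-input bundle, and apply the landed kernel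
`WildUpperHeegnerLineMD.wildUpperNonsurjTower_of_fourNamedFacts_of_maninDrinfeld` (k9-c4 g12, p575492).
[cite: MatarNekovar2019, Thm. 0.7 (p. 456)] [cite: GrossLMS1991, Prop. 3.7 (2)] [cite: Manin1972, Cor. 3.6] -/
theorem wildUpperNonsurjTowerOfFourNamedFacts_proof : WildUpperNonsurjTowerOfFourNamedFacts := by
  unfold WildUpperNonsurjTowerOfFourNamedFacts HeldMatarNekovarThm07 HeldGrossProp37Two HeldPoitouTateSelmerDuality
    HeldGrossZagierE0ImageFree WildUpperNonsurjRoadInputs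
  intro h1 h2 h3 h4 hI
  exact WildUpperHeegnerLineMD.wildUpperNonsurjTower_of_fourNamedFacts_of_maninDrinfeld h1 h2 h3 h4
    hI.1 hI.2.1 hI.2.2.1 hI.2.2.2.1 hI.2.2.2.2.1 hI.2.2.2.2.2

end Summit.BirchSwinnertonDyer.BirchSwinnertonDyer.Theorems
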